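import Literature.Computability.AlgebraicComplexity.BigCoppersmithWinograd
import Literature.Computability.AlgebraicComplexity.AsymptoticRankBorderRank
import Literature.Computability.AlgebraicComplexity.BorderRankFlattening
import Literature.Barriers.MatrixMultiplication.UniversalMethodBarrierCwCore
import HarnessLib

/-!
# `bR(CW_q) = R̃(CW_q) = q + 2`: discharge of `advxxz2025_asymptoticRank_bigCwTensor_le` and `BCS1997_algBorderRank_bigCwTensor`

Topic `Literature/Computability/AlgebraicComplexity`; sibling of `BigCoppersmithWinograd.lean`, which
proves Coppersmith–Winograd's border rank identity `bR(CW_q) ≤ q + 2`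
(`algBorderRank_bigCwTensor_le`; CW 1990, §7, eq. (10); BCS 1997, §15.8) and vendors the named
facts `advxxz2025_asymptoticRank_bigCwTensor_le` (Alman–Duan–Vassilevska Williams–Xu–Xu–Zhou 2025,
§3.6: "Coppersmith and Winograd [CW90] showed that `R̃(CW_q) ≤ q + 2`") and
`BCS1997_algBorderRank_bigCwTensor` (BCS 1997, §15.8: "Since `t` is concise we even have
`bR(t) = q + 2`"). Both are DISCHARGED here, by assembling results already in the tree:

* `asymptoticRank_bigCwTensor_le` — `R̃(CW_q) ≤ q + 2` over every commutative ring, from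
  `R̃ ≤ bR` (`asymptoticRank_le_algBorderRank`, `AsymptoticRankBorderRank.lean`; BCS Lemma (15.27));
  `advxxz2025_asymptoticRank_bigCwTensor_le_holds`.
* `asymptoticRank_bigCwTensor` — **`R̃(CW_q) = q + 2`** over every field, the lower bound being
  the flattening rank `q + 2 ≤ R̃(CW_q)` (`Literature.Barriers.MatrixMultiplication.le_asymptoticRank_bigCwTensor`,
  `UniversalMethodBarrierCwCore.lean`; Alman 2021, §4.1).
* `linearIndependent_bigCwTensor` — the `q + 2` slices `CW_q(xₐ, ·, ·)` are linearly independent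
  (`flatteningRank_bigCwTensor = q + 2`), hence by the conciseness bound for the border rank
  (`card_le_algBorderRank_of_linearIndependent`, `BorderRankFlattening.lean`; Bläser 2013, proof of
  Lemma 7.1(2)) `le_algBorderRank_bigCwTensor : q + 2 ≤ bR(CW_q)` and
  **`algBorderRank_bigCwTensor : bR(CW_q) = q + 2`** over every field, for all `q`
  (BCS state it for their standing `q ≥ 2`); `BCS1997_algBorderRank_bigCwTensor_holds`.

## References

* J. Alman, R. Duan, V. Vassilevska Williams, Y. Xu, Z. Xu, R. Zhou, *More asymmetry yields faster
  matrix multiplication*, SODA 2025, arXiv:2404.16349, §3.6. [AlmanDuanVassilevskaWilliamsXuXuZhou2025]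
* D. Coppersmith, S. Winograd, J. Symbolic Comput. 9 (1990), §7, eq. (10). [CoppersmithWinograd1990]
* P. Bürgisser, M. Clausen, M. A. Shokrollahi, *Algebraic Complexity Theory* (1997), §15.8 and
  Lemma (15.27). [BurgisserClausenShokrollahi1997]
* J. Alman, *Limits on the universal method for matrix multiplication*, Theory Comput. 17 (2021),
  §4.1 (`R̃(CW_q) ≥ q + 2`). [Alman2021]
* M. Bläser, *Fast Matrix Multiplication* (2013), Lemma 7.1(2) (proof: conciseness bound). [Blaser2013]
-/

noncomputable section

namespace Literature.Computability.AlgebraicComplexity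

open Literature.Barriers.MatrixMultiplication (bigCwTensor le_asymptoticRank_bigCwTensor
  flatteningRank_bigCwTensor)

universe u

/-! ## Asymptotic rank -/

/-- **`R̃(CW_q) ≤ q + 2`** over every commutative ring (`R̃ ≤ bR ≤ q + 2`).
[cite: AlmanDuanVassilevskaWilliamsXuXuZhou2025, §3.6] -/
theorem asymptoticRank_bigCwTensor_le (K : Type u) [CommRing K] (q : ℕ) :
    asymptoticRank (bigCwTensor K q) ≤ q + 2 := by
  have h := asymptoticRank_le_of_algBorderRank_le (algBorderRank_bigCwTensor_le K q)
  exact_mod_cast h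

/-- DISCHARGE of `advxxz2025_asymptoticRank_bigCwTensor_le` (ADVXXZ 2025, §3.6: "Coppersmith and
Winograd showed that `R̃(CW_q) ≤ q + 2`"). [cite: AlmanDuanVassilevskaWilliamsXuXuZhou2025, §3.6] -/
theorem advxxz2025_asymptoticRank_bigCwTensor_le_holds : advxxz2025_asymptoticRank_bigCwTensor_le :=
  fun K _ q => asymptoticRank_bigCwTensor_le K q

/-- **`R̃(CW_q) = q + 2`** over every field: the upper bound is Coppersmith–Winograd's border rank
identity, the lower bound the flattening rank (`le_asymptoticRank_bigCwTensor`).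
[cite: AlmanDuanVassilevskaWilliamsXuXuZhou2025, §3.6] -/
theorem asymptoticRank_bigCwTensor (K : Type u) [Field K] (q : ℕ) :
    asymptoticRank (bigCwTensor K q) = q + 2 :=
  le_antisymm (asymptoticRank_bigCwTensor_le K q) (by exact_mod_cast le_asymptoticRank_bigCwTensor q)

/-! ## Border rank -/

/-- The `q + 2` slices `a ↦ CW_q(xₐ, ·, ·)` are linearly independent (`CW_q` is concise;
`ζ⁽¹⁾(CW_q) = q + 2`, `flatteningRank_bigCwTensor`). [cite: BurgisserClausenShokrollahi1997, §15.8] -/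
theorem linearIndependent_bigCwTensor (K : Type u) [Field K] (q : ℕ) :
    LinearIndependent K (fun a => bigCwTensor K q a : Fin (q + 2) → Fin (q + 2) → Fin (q + 2) → K) := by
  have hx : LinearIndependent K (xSlices (bigCwTensor K q)) := by
    rw [linearIndependent_iff_card_eq_finrank_span, Fintype.card_fin]
    exact (flatteningRank_bigCwTensor (K := K) q).symm
  have h := hx.map' (LinearEquiv.curry K K (Fin (q + 2)) (Fin (q + 2))).toLinearMap
    (LinearEquiv.ker _)
  exact h

/-- **`q + 2 ≤ bR(CW_q)`** over every field (conciseness: `card_le_algBorderRank_of_linearIndependent`).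
[cite: BurgisserClausenShokrollahi1997, §15.8] -/
theorem le_algBorderRank_bigCwTensor (K : Type u) [Field K] (q : ℕ) :
    q + 2 ≤ algBorderRank (bigCwTensor K q) := by
  have h := card_le_algBorderRank_of_linearIndependent (bigCwTensor K q)
    (linearIndependent_bigCwTensor K q)
  rwa [Fintype.card_fin] at h

/-- **`bR(CW_q) = q + 2`** over every field (BCS 1997, §15.8: "`bR(t) ≤ q + 2`. (Since `t` is concise
we even have `bR(t) = q + 2`.)"). [cite: BurgisserClausenShokrollahi1997, §15.8] -/
theorem algBorderRank_bigCwTensor (K : Type u) [Field K] (q : ℕ) :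
    algBorderRank (bigCwTensor K q) = q + 2 :=
  le_antisymm (algBorderRank_bigCwTensor_le K q) (le_algBorderRank_bigCwTensor K q)

/-- DISCHARGE of `BCS1997_algBorderRank_bigCwTensor` (the hypothesis `2 ≤ q` of the printed statement
is not needed). [cite: BurgisserClausenShokrollahi1997, §15.8] -/
theorem BCS1997_algBorderRank_bigCwTensor_holds : BCS1997_algBorderRank_bigCwTensor :=
  fun K _ q _ => algBorderRank_bigCwTensor K q

end Literature.Computability.AlgebraicComplexity

end
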